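import Summits.ValiantsHypothesis.ValiantsHypothesis.Theorems.EquivariantDialBlockGaugeAssembly
import HarnessLib

/-!
# Finite lift groups ⟹ coordinate Levi lifts (LR17 §3.6 step 1, unconditional for finite lifts)

(decomp-valiant workshop, lens 1 «representation-theoretic obstruction splitting», generation 26, file 1 of 2) —
support file of the census cell `A = EquivariantDialNode.EqHardBiPerm` (item `stmt-ValiantsHypothesis-23702`); NOT a
route, closes NO item; pure linear algebra over a field of characteristic 0; no per, no complexity content; serves F2
(file 2 = `EquivariantDialFiniteLifts`: the finite-lift cell `A_fin`).  HONEST SCOPE: VP ≠ VNP is NOT proved here and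
nothing below is progress on it; no statement about `per` occurs in this file.

WHAT IS PROVED (sorry-free).  The g17 paper stub `CoLeviLifts` («a regular equivariant affine determinantal
representation can be replaced by one of the same size with COORDINATE LEVI LIFTS», tree
`EquivariantDialBlockGaugeAssembly`) becomes a THEOREM whenever the exact lifts `L_γ(A) = g A h⁻¹` can be chosen in a
FINITE group (M2 `exists_hasLeviLiftsAt_of_finLifts`):
* §1 `stabPair Λ` — the pairs `(g,h)` with `g Λ = Λ h` form a subgroup of `GL × GL` (the exact lifts of an affine
  matrix with constant part `Λ` lie in it: tree `mul_constPart_eq_of_linSubstEntries_eq`, LR17 Lemma 3.3); the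
  RANK-ONE GAUGE `P = 1 - (u - e_{i₀}) e_{i₀}ᵀ` (`exists_gauge`, row version `exists_gauge_row`): unipotent, `det = 1`,
  `P u = e_{i₀}`, `P Λ_{i₀} = Λ_{i₀}`.
* §2 MASCHKE AVERAGING IN COORDINATES (`exists_common_eigenvector`): a multiplicative family of matrices over a finite
  group whose `i₀`-th rows are `χ(p) e_{i₀}ᵀ` has a common eigenvector `v` with `v_{i₀} = 1` — the average
  `|G|⁻¹ ∑_p χ(p)⁻¹ g(p) e_{i₀}` [Serre, Linear representations, §1.3 Thm 1].
* §3 M1/M2: det-normalised LR normal form `A(0) = Λ_{i₀}` (`exists_normalForm_GL`, from the tree's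
  `IsRegularDetRepr.exists_normalForm`) ⟹ lifts in `stabPair Λ_{i₀}` ⟹ §2 on both sides ⟹ the two gauges straighten
  the common eigenvectors to `e_{i₀}` while fixing `Λ_{i₀}` ⟹ `HasLeviLiftsAt Γ A' i₀` with `det A' = f`.
GRADE (planner's reading): mechanism KNOWN (LR17 §3.3–3.6 + Maschke), kernel-NEW; 0 S-currency (a normal-form lemma
about equivariant representations, inside the equivariance barrier's model class; proves nothing about `per`).
References: [cite: LandsbergRessayre2017, Lemma 3.3, §3.6]; [cite: SerreLinearRepresentations1977, §1.3 Thm 1].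
-/

set_option linter.dupNamespace false

namespace Summit.ValiantsHypothesis.ValiantsHypothesis.Theorems.EquivariantDialLeviGauge

open MvPolynomial Matrix Literature.Computability.AlgebraicComplexity EquivariantDialLayers

noncomputable section

/-! ## §1 The stabiliser of a constant part and the rank-one gauge at `i₀` -/
section Tools
variable {k : Type*} [Field k] {n : Type*} [Fintype n] [DecidableEq n]

/-- The pairs `(g, h)` with `g Λ = Λ h`: a subgroup of `GL × GL` (LR17 §3.3; the exact lifts of an affine matrix
with constant part `Λ` lie in it, tree `mul_constPart_eq_of_linSubstEntries_eq`). -/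
def stabPair (Λ : Matrix n n k) : Subgroup (GL n k × GL n k) where
  carrier := {p | ((p.1 : GL n k) : Matrix n n k) * Λ = Λ * ((p.2 : GL n k) : Matrix n n k)}
  mul_mem' := fun {p q} hp hq => by
    simp only [Set.mem_setOf_eq, Prod.fst_mul, Prod.snd_mul, Units.val_mul] at hp hq ⊢
    rw [Matrix.mul_assoc, hq, ← Matrix.mul_assoc, hp, Matrix.mul_assoc]
  one_mem' := by
    simp only [Set.mem_setOf_eq, Prod.fst_one, Prod.snd_one, Units.val_one, Matrix.one_mul, Matrix.mul_one]
  inv_mem' := fun {p} hp => by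
    simp only [Set.mem_setOf_eq, Prod.fst_inv, Prod.snd_inv] at hp ⊢
    rw [Units.inv_mul_eq_iff_eq_mul, ← Matrix.mul_assoc, Units.eq_mul_inv_iff_mul_eq]
    exact hp.symm

/-- **THE RANK-ONE GAUGE AT `i₀`.**  For `u i₀ = 1`, the unipotent `P = 1 - (u - e_{i₀}) e_{i₀}ᵀ` has inverse
`P' = 1 + (u - e_{i₀}) e_{i₀}ᵀ` and determinant `1`, sends `u ↦ e_{i₀}` (`P'` sends `e_{i₀} ↦ u`) and fixes
`Λ_{i₀}` on the left (row `i₀` of `Λ_{i₀}` vanishes). -/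
theorem exists_gauge (i₀ : n) (u : n → k) (hu : u i₀ = 1) :
    ∃ P P' : Matrix n n k, P * P' = 1 ∧ P' * P = 1 ∧ P.det = 1 ∧ P *ᵥ u = Pi.single i₀ 1 ∧
      P' *ᵥ Pi.single i₀ 1 = u ∧ P * lamMatrix k i₀ = lamMatrix k i₀ := by
  have hew : Pi.single i₀ (1 : k) ⬝ᵥ (u - Pi.single i₀ 1) = 0 := by
    rw [single_dotProduct, one_mul, Pi.sub_apply, hu, Pi.single_eq_same, sub_self]
  have hXX : vecMulVec (u - Pi.single i₀ 1) (Pi.single i₀ (1 : k)) *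
      vecMulVec (u - Pi.single i₀ 1) (Pi.single i₀ (1 : k)) = 0 := by
    rw [vecMulVec_mul_vecMulVec, hew, zero_smul, vecMulVec_zero]
  have hrow : Pi.single i₀ (1 : k) ᵥ* lamMatrix k i₀ = 0 := by
    funext j
    rw [Matrix.single_one_vecMul, Matrix.row_apply, lamMatrix_apply, Pi.zero_apply]
    simp
  refine ⟨1 - vecMulVec (u - Pi.single i₀ 1) (Pi.single i₀ 1), 1 + vecMulVec (u - Pi.single i₀ 1) (Pi.single i₀ 1),
    ?_, ?_, ?_, ?_, ?_, ?_⟩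
  · rw [sub_mul, one_mul, mul_add, mul_one, hXX, add_zero, add_sub_cancel_right]
  · rw [add_mul, one_mul, mul_sub, mul_one, hXX, sub_zero, sub_add_cancel]
  · rw [sub_eq_add_neg, ← neg_vecMulVec, vecMulVec_eq Unit, Matrix.det_one_add_replicateCol_mul_replicateRow,
      dotProduct_neg, hew, neg_zero, add_zero]
  · rw [Matrix.sub_mulVec, Matrix.one_mulVec, vecMulVec_mulVec, single_dotProduct, one_mul, hu,
      MulOpposite.op_one, one_smul, sub_sub_cancel]
  · rw [Matrix.add_mulVec, Matrix.one_mulVec, vecMulVec_mulVec, single_dotProduct, one_mul, Pi.single_eq_same,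
      MulOpposite.op_one, one_smul, add_sub_cancel]
  · rw [sub_mul, one_mul, vecMulVec_mul, hrow, vecMulVec_zero, sub_zero]

/-- The ROW version of `exists_gauge` (transposes): `u S = e_{i₀}ᵀ`, `e_{i₀}ᵀ S' = u`, `Λ_{i₀} S = Λ_{i₀}`. -/
theorem exists_gauge_row (i₀ : n) (u : n → k) (hu : u i₀ = 1) :
    ∃ S S' : Matrix n n k, S * S' = 1 ∧ S' * S = 1 ∧ S.det = 1 ∧ u ᵥ* S = Pi.single i₀ 1 ∧
      Pi.single i₀ 1 ᵥ* S' = u ∧ lamMatrix k i₀ * S = lamMatrix k i₀ := by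
  obtain ⟨P, P', h1, h2, h3, h4, h5, h6⟩ := exists_gauge i₀ u hu
  have hΛT : (lamMatrix k i₀)ᵀ = lamMatrix k i₀ := by rw [lamMatrix, Matrix.diagonal_transpose]
  refine ⟨Pᵀ, P'ᵀ, ?_, ?_, ?_, ?_, ?_, ?_⟩
  · rw [← Matrix.transpose_mul, h2, Matrix.transpose_one]
  · rw [← Matrix.transpose_mul, h1, Matrix.transpose_one]
  · rw [Matrix.det_transpose, h3]
  · rw [Matrix.vecMul_transpose, h4]
  · rw [Matrix.vecMul_transpose, h5]
  · rw [← hΛT, ← Matrix.transpose_mul, h6]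

end Tools

/-! ## §2 Maschke averaging in coordinates -/
section Average
variable {k : Type*} [Field k] [CharZero k] {n : Type*} [Fintype n] [DecidableEq n]
  {G : Type*} [Group G] [Finite G]

/-- **MASCHKE AVERAGING IN COORDINATES.**  A multiplicative family `g : G → Mat_n(k)` (`G` finite, `char k = 0`)
whose `i₀`-th rows are supported at `(i₀, i₀)` (the hyperplane `{v | v i₀ = 0}` is stable) has a COMMON EIGENVECTOR
`v` with `v i₀ = 1`: `g(q) v = χ(q) v`, `χ(q) = g(q)_{i₀ i₀}`; `v = |G|⁻¹ ∑_p χ(p)⁻¹ g(p) e_{i₀}` (Maschke's average). -/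
theorem exists_common_eigenvector (g : G → Matrix n n k) (hmul : ∀ p q, g (p * q) = g p * g q)
    (hone : g 1 = 1) (i₀ : n) (hrow : ∀ p j, j ≠ i₀ → g p i₀ j = 0) :
    ∃ v : n → k, v i₀ = 1 ∧ ∀ q, g q *ᵥ v = g q i₀ i₀ • v := by
  haveI := Fintype.ofFinite G
  have hχ : ∀ p q, g (p * q) i₀ i₀ = g p i₀ i₀ * g q i₀ i₀ := fun p q => by
    rw [hmul, Matrix.mul_apply]
    exact Finset.sum_eq_single i₀ (fun j _ hj => by rw [hrow p j hj, zero_mul])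
      (fun h => (h (Finset.mem_univ _)).elim)
  have hχ0 : ∀ p, g p i₀ i₀ ≠ 0 := fun p h0 => by
    have h1 := hχ p p⁻¹
    rw [mul_inv_cancel, hone, Matrix.one_apply_eq, h0, zero_mul] at h1
    exact one_ne_zero h1
  have hN : (Fintype.card G : k) ≠ 0 := Nat.cast_ne_zero.mpr Fintype.card_ne_zero
  have h1 : ∀ p, (g p i₀ i₀)⁻¹ * g p i₀ i₀ = 1 := fun p => inv_mul_cancel₀ (hχ0 p)
  refine ⟨fun i => (Fintype.card G : k)⁻¹ * ∑ p, (g p i₀ i₀)⁻¹ * g p i i₀, ?_, fun q => ?_⟩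
  · simp only [h1, Finset.sum_const, Finset.card_univ, nsmul_eq_mul, mul_one]
    exact inv_mul_cancel₀ hN
  · ext i
    show ∑ j, g q i j * ((Fintype.card G : k)⁻¹ * ∑ p, (g p i₀ i₀)⁻¹ * g p j i₀) =
      g q i₀ i₀ * ((Fintype.card G : k)⁻¹ * ∑ p, (g p i₀ i₀)⁻¹ * g p i i₀)
    have hre : ∑ p, (g (q * p) i₀ i₀)⁻¹ * g (q * p) i i₀ = ∑ p, (g p i₀ i₀)⁻¹ * g p i i₀ :=
      Fintype.sum_equiv (Equiv.mulLeft q) _ _ fun _ => by simp only [Equiv.coe_mulLeft]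
    calc ∑ j, g q i j * ((Fintype.card G : k)⁻¹ * ∑ p, (g p i₀ i₀)⁻¹ * g p j i₀)
        = (Fintype.card G : k)⁻¹ * ∑ p, (g p i₀ i₀)⁻¹ * ∑ j, g q i j * g p j i₀ := by
          simp only [Finset.mul_sum]
          rw [Finset.sum_comm]
          exact Finset.sum_congr rfl fun p _ => Finset.sum_congr rfl fun j _ => by ring
      _ = (Fintype.card G : k)⁻¹ * ∑ p, (g p i₀ i₀)⁻¹ * g (q * p) i i₀ := by
          simp only [hmul, Matrix.mul_apply]
      _ = (Fintype.card G : k)⁻¹ * ∑ p, g q i₀ i₀ * ((g (q * p) i₀ i₀)⁻¹ * g (q * p) i i₀) := by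
          refine congrArg _ (Finset.sum_congr rfl fun p _ => ?_)
          rw [hχ q p]
          linear_combination (-((g p i₀ i₀)⁻¹ * g (q * p) i i₀)) * mul_inv_cancel₀ (hχ0 q)
      _ = g q i₀ i₀ * ((Fintype.card G : k)⁻¹ * ∑ p, (g p i₀ i₀)⁻¹ * g p i i₀) := by
          rw [← Finset.mul_sum, hre]; ring

end Average

/-! ## §3 Finite lift groups ⟹ coordinate Levi lifts -/
section Levi
variable {σ : Type*} {k : Type*} [Field k]

/-- STEP 1 WITH UNITS (det-normalised LR frame): a regular affine representation of `f` is carried by a constant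
gauge `(W, U)`, `W = diag(1,…,(det V det U)⁻¹,…,1) · V`, to an affine representation OF `f` with `A(0) = Λ_{i₀}`. -/
theorem exists_normalForm_GL {f : MvPolynomial σ k} {s : ℕ} (hs : 0 < s)
    {A : Matrix (Fin s) (Fin s) (MvPolynomial σ k)} (hA : IsRegularDetRepr f A) :
    ∃ (W U : GL (Fin s) k) (i₀ : Fin s),
      IsAffineDetRepr f ((W : Matrix (Fin s) (Fin s) k).map C * A * (U : Matrix (Fin s) (Fin s) k).map C) ∧
      constPart ((W : Matrix (Fin s) (Fin s) k).map C * A * (U : Matrix (Fin s) (Fin s) k).map C) = lamMatrix k i₀ := by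
  obtain ⟨V, U, i₀, hV, hU, hΛ⟩ := hA.exists_normalForm hs
  have hVd : V.det ≠ 0 := ((Matrix.isUnit_iff_isUnit_det V).mp hV).ne_zero
  have hUd : U.det ≠ 0 := ((Matrix.isUnit_iff_isUnit_det U).mp hU).ne_zero
  have hΛ' : V * constPart A * U = lamMatrix k i₀ := by
    rwa [constPart_mul, constPart_mul, constPart_map_C, constPart_map_C] at hΛ
  have hDdet : (Matrix.diagonal (Function.update 1 i₀ (V.det * U.det)⁻¹)).det = (V.det * U.det)⁻¹ := by
    rw [Matrix.det_diagonal, Finset.prod_update_of_mem (Finset.mem_univ i₀)]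
    simp only [Pi.one_apply, Finset.prod_const_one, mul_one]
  have hDΛ : Matrix.diagonal (Function.update 1 i₀ (V.det * U.det)⁻¹) * lamMatrix k i₀ = lamMatrix k i₀ := by
    rw [lamMatrix, Matrix.diagonal_mul_diagonal]
    refine congrArg Matrix.diagonal (funext fun i => ?_)
    by_cases hi : i = i₀
    · rw [if_pos hi, mul_zero]
    · rw [if_neg hi, Function.update_of_ne hi, Pi.one_apply, one_mul]
  have hWd : (Matrix.diagonal (Function.update 1 i₀ (V.det * U.det)⁻¹) * V).det ≠ 0 := by
    rw [Matrix.det_mul, hDdet]; exact mul_ne_zero (inv_ne_zero (mul_ne_zero hVd hUd)) hVd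
  refine ⟨Matrix.GeneralLinearGroup.mkOfDetNeZero _ hWd, Matrix.GeneralLinearGroup.mkOfDetNeZero U hUd, i₀, ?_⟩
  rw [Matrix.GeneralLinearGroup.val_mkOfDetNeZero, Matrix.GeneralLinearGroup.val_mkOfDetNeZero]
  refine ⟨⟨totalDegree_map_C_mul_mul_map_C_le _ _ hA.1.1, ?_⟩, ?_⟩
  · rw [det_map_C_mul_mul_map_C, Matrix.det_mul, hDdet, mul_assoc, inv_mul_cancel₀ (mul_ne_zero hVd hUd), map_one,
      one_mul, hA.1.2]
  · rw [Matrix.map_mul, constPart_mul, constPart_mul, constPart_mul, constPart_map_C, constPart_map_C,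
      constPart_map_C, ← hDΛ, ← hΛ']
    simp only [Matrix.mul_assoc]

variable [Fintype σ] [DecidableEq σ]

/-- TRANSPORT OF AN EXACT LIFT along a constant gauge `A ↦ L A R`: the lift `(g, h)` becomes `(L g L⁻¹, R⁻¹ h R)`. -/
theorem linSubstEntries_gauge {ι : Type*} [Fintype ι] [DecidableEq ι] {γ : GL σ k}
    {A : Matrix ι ι (MvPolynomial σ k)} {g h : GL ι k}
    (hA : Matrix.linSubstEntries γ A = (g : Matrix ι ι k).map C * A * ((h⁻¹ : GL ι k) : Matrix ι ι k).map C)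
    (L R : GL ι k) :
    Matrix.linSubstEntries γ ((L : Matrix ι ι k).map C * A * (R : Matrix ι ι k).map C) =
      ((L * g * L⁻¹ : GL ι k) : Matrix ι ι k).map C * ((L : Matrix ι ι k).map C * A * (R : Matrix ι ι k).map C) *
        (((R⁻¹ * h * R)⁻¹ : GL ι k) : Matrix ι ι k).map C := by
  rw [Matrix.linSubstEntries_mul, Matrix.linSubstEntries_mul, Matrix.linSubstEntries_map_C,
    Matrix.linSubstEntries_map_C, hA]
  simp only [_root_.mul_inv_rev, inv_inv, Units.val_mul, Matrix.map_mul, Matrix.mul_assoc, inv_map_C_mul_cancel_left,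
    map_C_mul_inv_cancel_left]

/-- **M1 (KERNEL).**  An affine representation of `f` with `A(0) = Λ_{i₀}` whose lifts form two multiplicative
families `g, h : G → GL_s` over a FINITE group `G` admits, after a constant gauge of determinant one fixing `Λ_{i₀}`,
COORDINATE LEVI LIFTS at `i₀` (LR17 Lemma 3.3 + Maschke on both sides + the two rank-one gauges). -/
theorem exists_hasLeviLiftsAt_of_normalForm [CharZero k] {Γ : Subgroup (GL σ k)} {f : MvPolynomial σ k} {s : ℕ}
    {A : Matrix (Fin s) (Fin s) (MvPolynomial σ k)} {i₀ : Fin s} (hA : IsAffineDetRepr f A)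
    (hΛ : constPart A = lamMatrix k i₀) {G : Type*} [Group G] [Finite G] (g h : G → GL (Fin s) k)
    (hg : ∀ p q, g (p * q) = g p * g q) (hh : ∀ p q, h (p * q) = h p * h q)
    (hlift : ∀ γ ∈ Γ, ∃ p : G, Matrix.linSubstEntries γ A =
      ((g p : GL (Fin s) k) : Matrix (Fin s) (Fin s) k).map C * A *
        (((h p)⁻¹ : GL (Fin s) k) : Matrix (Fin s) (Fin s) k).map C) :
    ∃ A' : Matrix (Fin s) (Fin s) (MvPolynomial σ k), IsAffineDetRepr f A' ∧ HasLeviLiftsAt Γ A' i₀ := by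
  have hg1 : g 1 = 1 := mul_left_cancel (a := g 1) (by rw [← hg, mul_one, mul_one])
  have hh1 : h 1 = 1 := mul_left_cancel (a := h 1) (by rw [← hh, mul_one, mul_one])
  let ρ : G →* GL (Fin s) k × GL (Fin s) k :=
    MonoidHom.mk' (fun p => (g p, h p)) fun p q => by simp only [hg, hh, Prod.mk_mul_mk]
  let G' : Subgroup G := (stabPair (lamMatrix k i₀)).comap ρ
  have hmem : ∀ {p : G}, p ∈ G' ↔ ((g p : GL (Fin s) k) : Matrix (Fin s) (Fin s) k) * lamMatrix k i₀ =
      lamMatrix k i₀ * ((h p : GL (Fin s) k) : Matrix (Fin s) (Fin s) k) := Iff.rfl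
  -- every lift stabilises the constant part (LR17 Lemma 3.3), so lifts may be taken in `G'`
  have hliftG' : ∀ γ ∈ Γ, ∃ p : G', Matrix.linSubstEntries γ A =
      ((g p : GL (Fin s) k) : Matrix (Fin s) (Fin s) k).map C * A *
        (((h p)⁻¹ : GL (Fin s) k) : Matrix (Fin s) (Fin s) k).map C := by
    intro γ hγ
    obtain ⟨p, hp⟩ := hlift γ hγ
    refine ⟨⟨p, hmem.mpr ?_⟩, hp⟩
    have e := mul_constPart_eq_of_linSubstEntries_eq hp
    rwa [hΛ] at e
  have hrowg : ∀ (p : G') (j : Fin s), j ≠ i₀ → ((g p : GL (Fin s) k) : Matrix (Fin s) (Fin s) k) i₀ j = 0 :=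
    fun p => ((mul_lamMatrix_eq_lamMatrix_mul_iff i₀ _ _).mp (hmem.mp p.2)).1
  have hcolh : ∀ (p : G') (i : Fin s), i ≠ i₀ → ((h p : GL (Fin s) k) : Matrix (Fin s) (Fin s) k) i i₀ = 0 :=
    fun p => ((mul_lamMatrix_eq_lamMatrix_mul_iff i₀ _ _).mp (hmem.mp p.2)).2.1
  -- Maschke on both sides (for `h` apply the lemma to `p ↦ (h p⁻¹)ᵀ`), then the two rank-one gauges
  obtain ⟨v, hv0, hv⟩ := exists_common_eigenvector (G := G')
    (fun p => ((g p : GL (Fin s) k) : Matrix (Fin s) (Fin s) k))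
    (fun p q => by simp only [Subgroup.coe_mul, hg, Units.val_mul])
    (by simp only [Subgroup.coe_one, hg1, Units.val_one]) i₀ hrowg
  have hv' : ∀ p : G', ((g p : GL (Fin s) k) : Matrix (Fin s) (Fin s) k) *ᵥ v =
      ((g p : GL (Fin s) k) : Matrix (Fin s) (Fin s) k) i₀ i₀ • v := fun p => hv p
  obtain ⟨φ, hφ0, hφ⟩ := exists_common_eigenvector (G := G')
    (fun p => (((h (p⁻¹ : G') : GL (Fin s) k) : Matrix (Fin s) (Fin s) k))ᵀ)
    (fun p q => by simp only [_root_.mul_inv_rev, Subgroup.coe_mul, hh, Units.val_mul, Matrix.transpose_mul])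
    (by simp only [inv_one, Subgroup.coe_one, hh1, Units.val_one, Matrix.transpose_one]) i₀
    (fun p j hj => by simp only [Matrix.transpose_apply]; exact hcolh p⁻¹ j hj)
  have hφ' : ∀ p : G', φ ᵥ* ((h p : GL (Fin s) k) : Matrix (Fin s) (Fin s) k) =
      ((h p : GL (Fin s) k) : Matrix (Fin s) (Fin s) k) i₀ i₀ • φ := fun p => by
    have e : (((h ((p⁻¹)⁻¹ : G') : GL (Fin s) k) : Matrix (Fin s) (Fin s) k))ᵀ *ᵥ φ =
        (((h ((p⁻¹)⁻¹ : G') : GL (Fin s) k) : Matrix (Fin s) (Fin s) k))ᵀ i₀ i₀ • φ := hφ p⁻¹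
    rwa [inv_inv, Matrix.mulVec_transpose, Matrix.transpose_apply] at e
  obtain ⟨P, P', hPP', hP'P, hPdet, hPv, hP'e, hPΛ⟩ := exists_gauge i₀ v hv0
  obtain ⟨S, S', hSS', hS'S, hSdet, hφS, heS', hΛS⟩ := exists_gauge_row i₀ φ hφ0
  let L : GL (Fin s) k := ⟨P, P', hPP', hP'P⟩
  let R : GL (Fin s) k := ⟨S, S', hSS', hS'S⟩
  have hLv : ((L : GL (Fin s) k) : Matrix (Fin s) (Fin s) k) = P := rfl
  have hLi : ((L⁻¹ : GL (Fin s) k) : Matrix (Fin s) (Fin s) k) = P' := rfl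
  have hRv : ((R : GL (Fin s) k) : Matrix (Fin s) (Fin s) k) = S := rfl
  have hRi : ((R⁻¹ : GL (Fin s) k) : Matrix (Fin s) (Fin s) k) = S' := rfl
  refine ⟨((L : GL (Fin s) k) : Matrix (Fin s) (Fin s) k).map C * A * ((R : GL (Fin s) k) : Matrix (Fin s) (Fin s) k).map C,
    ⟨totalDegree_map_C_mul_mul_map_C_le _ _ hA.1, ?_⟩, ?_, fun γ hγ => ?_⟩
  · rw [det_map_C_mul_mul_map_C, hLv, hRv, hPdet, hSdet, mul_one, map_one, one_mul, hA.2]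
  · rw [constPart_mul, constPart_mul, constPart_map_C, constPart_map_C, hΛ, hLv, hRv, hPΛ, hΛS]
  · obtain ⟨p, hp⟩ := hliftG' γ hγ
    refine ⟨L * g p * L⁻¹, R⁻¹ * h p * R, linSubstEntries_gauge hp L R, fun j hj => ⟨?_, ?_⟩⟩
    · have hcol : ((L * g p * L⁻¹ : GL (Fin s) k) : Matrix (Fin s) (Fin s) k) *ᵥ Pi.single i₀ 1 =
          ((g p : GL (Fin s) k) : Matrix (Fin s) (Fin s) k) i₀ i₀ • Pi.single i₀ 1 := by
        rw [Units.val_mul, Units.val_mul, hLv, hLi, ← Matrix.mulVec_mulVec, ← Matrix.mulVec_mulVec, hP'e, hv' p,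
          Matrix.mulVec_smul, hPv]
      have hc := congrFun hcol j
      rwa [Matrix.mulVec_single_one, Matrix.col_apply, Pi.smul_apply, Pi.single_eq_of_ne hj, smul_zero] at hc
    · have hrow : Pi.single i₀ 1 ᵥ* ((R⁻¹ * h p * R : GL (Fin s) k) : Matrix (Fin s) (Fin s) k) =
          ((h p : GL (Fin s) k) : Matrix (Fin s) (Fin s) k) i₀ i₀ • Pi.single i₀ 1 := by
        rw [Units.val_mul, Units.val_mul, hRv, hRi, ← Matrix.vecMul_vecMul, ← Matrix.vecMul_vecMul, heS', hφ' p,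
          Matrix.smul_vecMul, hφS]
      have hr := congrFun hrow j
      rwa [Matrix.single_one_vecMul, Matrix.row_apply, Pi.smul_apply, Pi.single_eq_of_ne hj, smul_zero] at hr

/-- **M2 (KERNEL): finite lift group ⟹ coordinate Levi lifts.**  A REGULAR affine determinantal representation of
`f` whose exact lifts can be chosen as `ρ(p)`, `p` in a FINITE group `G`, `ρ : G →* GL_s × GL_s`, is gauge-equivalent
to one of the same size with coordinate Levi lifts — the conclusion of the g17 stub `CoLeviLifts`, for finite lifts. -/
theorem exists_hasLeviLiftsAt_of_finLifts [CharZero k] {Γ : Subgroup (GL σ k)} {f : MvPolynomial σ k} {s : ℕ}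
    (hs : 0 < s) {A : Matrix (Fin s) (Fin s) (MvPolynomial σ k)} (hA : IsRegularDetRepr f A)
    {G : Type*} [Group G] [Finite G] (ρ : G →* GL (Fin s) k × GL (Fin s) k)
    (hlift : ∀ γ ∈ Γ, ∃ p : G, Matrix.linSubstEntries γ A =
      (((ρ p).1 : GL (Fin s) k) : Matrix (Fin s) (Fin s) k).map C * A *
        (((ρ p).2⁻¹ : GL (Fin s) k) : Matrix (Fin s) (Fin s) k).map C) :
    ∃ (A' : Matrix (Fin s) (Fin s) (MvPolynomial σ k)) (i₀ : Fin s),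
      IsAffineDetRepr f A' ∧ HasLeviLiftsAt Γ A' i₀ := by
  obtain ⟨W, U, i₀, hA₁, hΛ⟩ := exists_normalForm_GL hs hA
  obtain ⟨A', hA', hL⟩ := exists_hasLeviLiftsAt_of_normalForm hA₁ hΛ
    (fun p => W * (ρ p).1 * W⁻¹) (fun p => U⁻¹ * (ρ p).2 * U)
    (fun p q => by simp only [map_mul, Prod.fst_mul, mul_assoc, inv_mul_cancel_left])
    (fun p q => by simp only [map_mul, Prod.snd_mul, mul_assoc, mul_inv_cancel_left])
    (fun γ hγ => (hlift γ hγ).imp fun p hp => linSubstEntries_gauge hp W U)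
  exact ⟨A', i₀, hA', hL⟩

end Levi

end

end Summit.ValiantsHypothesis.ValiantsHypothesis.Theorems.EquivariantDialLeviGauge
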